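import Summits.Ventures.PackingBounds.ThreePointCert.C5TData11

/-!
# A(5, arccos 1/3) ≤ 23 (three-point bound, kernel-checked): the certificate and expansion records

Framing: lottery ticket; floor = certified bounds/negative ranges. Venture `PackingBounds` (cell
`pub-packcert`), three-point SDP family. Integer data of a feasible point of the Bachoc–Vallentin
semidefinite program (n = 5, s = 1/3, degree d = 8, symmetric
sums of squares), derived by `pub-packcert-sdp/code/cert2lean.py` from the exact rational
certificate `sdp-n5-d8-s1-3-sym.json` of the cell (two independent exact verifiers + referee), in the
units of the kernel checker `ThreePointCert.Check` (soundness `ThreePointCert.Sound`). Generated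
file: plain lists of integers / monomials.
-/

namespace Summit.Ventures.PackingBounds.ThreePointCert.C5T

open Literature.Geometry.DiscreteGeometry Literature.Geometry.DiscreteGeometry.PolyCert PolyCert.SPoly

/-- The claimed expansion data (validated in the `Expand` files). -/
def polys : CertPolys3 := CertPolys3.mk eFP eR0 eR1 eR2 eR3 eR4 eQ0 eQ1

end Summit.Ventures.PackingBounds.ThreePointCert.C5T
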